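import Literature.NumberTheory.Automorphic.ArchRankOneCasimirUniform              -- ★ p850750 (LH3-p04 (g4)): (ELL-∞-UNIF) `exists_forall_eventually_norm_iteratedDeriv_orbitalIntegral_comp_clm_le`; brings ★ p850639 ladder heads, ★ p850669
import Literature.NumberTheory.Automorphic.ArchRankOneJumpZeroCayley              -- ★ (K0±)-CAYLEY (LH10-p02 (g3)): `integral_comp_conj_transport` (the torus point moves with the frame)
import Literature.NumberTheory.Automorphic.ArchEndoscopicChartOrbitalContinuity   -- ★ p849873: `formCongr_cayleyTwo_eq_map_diagonal` (`P̄ᵀ (σ_w Φ₂) P = σ_w diag(2,−2)`)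
import HarnessLib

/-!
# The all-orders Casimir ladder of the normalised elliptic orbital integral IN THE CAYLEY FRAME of `U(Φ₂)_w` — the compact chart of `H_∞` at a compact place
# (dock (α2) of ★ `ArchRankOneCasimirLadder`∕`…Uniform` onto the tree's atlas: Varadarajan 1989 §6.4 Thms 22–24; Bouaziz 1994 §3.1 (I₂); Rogawski 1990 §8.2)

Topic `NumberTheory/Automorphic`; namespace `Literature.NumberTheory.Automorphic.UnitaryGroup`.  THEOREMS ONLY (no `def`, no instance, no axiom, no `sorry`).  Cell `pub/hodgecm-mathlib`,
crux H413 (`stmt-HodgeConjecture-24833`), line LH3 (closer stub `stub_N9`, DIRECT ROAD), organ O-L3′ conjunct (ii) pay-down for GENERAL `fH` (LH3-plan (g3) RULINGS #11), stage (α2)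
of the transport of the one-place engine to `h2` (LH3-p01 (g4) 2026-09-02T09:06Z plan).  Author LH3-p01 (g4).  Count-neutral.

THE POINT.  ★ (ELL-∞) states Harish-Chandra's all-orders behaviour of `F_f(ψ) = 2 sin ψ · ∫ f(↑↑(h t_z(ψ) h⁻¹)) dμ(h)` on the DIAGONAL-form group `U(σ_w diag(a))(ℂ)`,
`t_z(ψ) = diag(z e^{iψ}, z e^{−iψ})`.  The compact chart of `H_∞ = U(Φ₂)_∞ × U(Φ₁)_∞` at a compact place `w ∉ S` (★ (T-ATLAS) `endoBlockAt S w`, ★ per-place leaves p850744) lives on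
the ANTI-DIAGONAL-form group `U(Φ₂)_w = archLocal L 2 Φ₂ w` and is the CAYLEY torus `P · t_z(ψ) · P⁻¹`, `P = (1 1; 1 −1)`, along the normal `(θ₀, θ₂) = (θ + ψ, θ − ψ)` of the wall
`θ₀ = θ₂` (`z = e^{iθ}`).  Since `P̄ᵀ (σ_w Φ₂) P = σ_w diag(2,−2)` (★ `formCongr_cayleyTwo_eq_map_diagonal`), `e : h′ ↦ P h′ P⁻¹` is a topological-group isomorphism
`U(σ_w diag(2,−2))(ℂ) ≃ₜ* U(Φ₂)_w` (★ `unitaryGroupOfFormCongrOfEq`), and for every measure `ν` on `U(Φ₂)_w` and every `f` (★ `integral_comp_conj_transport`)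
  `2 sin ψ · ∫_{U(Φ₂)_w} f(↑↑(h · P t_z(ψ) P⁻¹ · h⁻¹)) dν(h) = 2 sin ψ · ∫_{U(σ_w diag(2,−2))} (f ∘ Ad_P)(↑↑(h′ t_z(ψ) h′⁻¹)) d(ν ∘ e)(h′)`  for EVERY `ψ`
— the Cayley-frame functional IS the engine's functional for the transported Haar measure `ν.map e⁻¹` and the transported test function `X ↦ f(P X P⁻¹)` (`C_c^∞` again), at
`a = (2, −2)`, `p = q = 1`.  Hence every ★ (ELL-∞) head transfers VERBATIM (same function of `ψ`):
* §1 frame bookkeeping: `exists_cayleyEquiv_diagonal` (the `≃ₜ*` with its value formula), `isMulRightInvariant_map_continuousMulEquiv`, `contDiff_hasCompactSupport_comp_cayley`,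
  the engine's side conditions at `a = (2,−2)` (`two_neg_two_ne_zero`, `…_im_eq_zero`, `…_re_mul_re_neg`, `…_hqe`), and **`two_sin_smul_orbitalIntegral_cayley_eq`** (the function-of-`ψ`
  identity above);
* §2 HEADS on `U(Φ₂)_w` (any Haar `ν`, `E` Banach, `f ∈ C_c^∞(M₂(ℂ), E)`, `z ∈ S¹`): **`exists_forall_eventually_norm_iteratedDeriv_orbitalIntegral_cayley_le`** (bounded jets near the
  wall = the one-place `h2` at a compact place of `H_∞`), **`exists_tendsto_iteratedDeriv_orbitalIntegral_cayley_nhdsGT_nhdsLT`** (every jet has one-sided limits),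
  **`exists_forall_eventually_norm_iteratedDeriv_orbitalIntegral_cayley_comp_clm_le`** (★ (ELL-∞-UNIF): `‖(F (ℓ ∘ g))⁽ⁿ⁾ ψ‖ ≤ ‖ℓ‖ · B` simultaneously for all CLMs `ℓ : E′ →L E` —
  the `P →ᵇ E` uniformity the multi-place transport (α3)∕(α4) consumes with the other places' leaf variables curried into `g`).
HONEST LABEL: HC_CM is proved only modulo the 7 printed citations (2 remaining: hLiu418 = stmt-HodgeConjecture-24832, h413 = stmt-HodgeConjecture-24833) until rung 0 closes;
frame bookkeeping over ★ (ELL-∞), pays nothing by itself.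

## References
* [Varadarajan1989] V. S. Varadarajan, *An Introduction to Harmonic Analysis on Semisimple Lie Groups* (1989), §6.4 Thms 22–24.
* [Bouaziz1994IntegralesOrbitales] A. Bouaziz, *Intégrales orbitales sur les algèbres de Lie réductives*, Invent. Math. 115 (1994), §3.1 (I₁)–(I₂) p. 579.
* [Rogawski1990] J. D. Rogawski, *Automorphic Representations of Unitary Groups in Three Variables*, Ann. of Math. Stud. 123 (1990), §8.2 pp. 119, 122 (the Cayley frame).
* [PlatonovRapinchuk1994] V. Platonov, A. Rapinchuk, *Algebraic Groups and Number Theory* (1994), §2.3 (change of frame for unitary groups).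
-/

set_option autoImplicit false

noncomputable section

namespace Literature.NumberTheory.Automorphic.UnitaryGroup

open _root_.Complex _root_.Matrix _root_.MeasureTheory _root_.Set _root_.Filter _root_.Topology _root_.NumberField _root_.NumberField.InfinitePlace
open Literature.NumberTheory.Automorphic.RankOneCasimir
open scoped Matrix.Norms.Operator MatrixGroups ComplexConjugate ContDiff Real

variable {E : Type*} [NormedAddCommGroup E] [NormedSpace ℝ E]

/-! ## §1 Frame bookkeeping at `a = (2, −2)`, `p = q = 1` -/

section Frame

variable (L : Type) [Field L] [NumberField L] (w : {w : InfinitePlace L // IsComplex w})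

/-- **The Cayley congruence `h′ ↦ P h′ P⁻¹ : U(σ_w diag(2,−2))(ℂ) ≃ₜ* U(Φ₂)_w`** (★ `unitaryGroupOfFormCongrOfEq` along ★ `formCongr_cayleyTwo_eq_map_diagonal`), with its value formula; the
domain is LITERALLY the carrier of ★ (ELL-∞) at `a = (2, −2)`. [cite: Rogawski1990, §8.2 p. 122] [cite: PlatonovRapinchuk1994, §2.3] -/
theorem exists_cayleyEquiv_diagonal :
    ∃ e : ↥(unitaryGroupOfForm (starRingEnd ℂ) ((Matrix.diagonal ![(2 : L), -2]).map w.1.embedding)) ≃ₜ*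
        ↥(archLocal L 2 (Matrix.of fun i j : Fin 2 => if i.val + j.val + 1 = 2 then (1 : L) else 0) w),
      ∀ h' : ↥(unitaryGroupOfForm (starRingEnd ℂ) ((Matrix.diagonal ![(2 : L), -2]).map w.1.embedding)),
        ((e h' : ↥(archLocal L 2 (Matrix.of fun i j : Fin 2 => if i.val + j.val + 1 = 2 then (1 : L) else 0) w)) : GL (Fin 2) ℂ) =
          Matrix.GeneralLinearGroup.mkOfDetNeZero !![(1 : ℂ), 1; 1, -1] det_cayleyTwo_ne_zero * (h' : GL (Fin 2) ℂ) *
            (Matrix.GeneralLinearGroup.mkOfDetNeZero !![(1 : ℂ), 1; 1, -1] det_cayleyTwo_ne_zero)⁻¹ :=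
  ⟨unitaryGroupOfFormCongrOfEq (starRingEnd ℂ) (Matrix.GeneralLinearGroup.mkOfDetNeZero !![(1 : ℂ), 1; 1, -1] det_cayleyTwo_ne_zero) _ _
      (formCongr_cayleyTwo_eq_map_diagonal L w), fun _ => rfl⟩

omit [Field L] [NumberField L] in
/-- Right invariance passes along a measurable multiplicative equivalence. [folklore] -/
private theorem isMulRightInvariant_map_mulEquiv'' {A B : Type*} [Group A] [Group B] [MeasurableSpace A] [MeasurableSpace B]
    [MeasurableMul A] [MeasurableMul B] (f : A ≃* B) (hf : Measurable f) (μ : Measure A) [μ.IsMulRightInvariant] :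
    (Measure.map f μ).IsMulRightInvariant := by
  -- adapted from ★ `ArchChartOrbHaarScaling` (private `isMulRightInvariant_map_mulEquiv'`)
  refine ⟨fun b => ?_⟩
  obtain ⟨a, rfl⟩ := f.surjective b
  rw [Measure.map_map (measurable_mul_const (f a)) hf]
  have h1 : (fun x => x * f a) ∘ ⇑f = ⇑f ∘ fun x => x * a := by
    funext x; simp only [Function.comp_apply, map_mul]
  rw [h1, ← Measure.map_map hf (measurable_mul_const a), map_mul_right_eq_self μ a]

omit [Field L] [NumberField L] in
/-- `X ↦ f(P X P⁻¹)` is `C_c^∞` when `f` is (`Ad_P` is a linear homeomorphism of `M₂(ℂ)`). [folklore] -/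
private theorem contDiff_hasCompactSupport_comp_cayley {E' : Type*} [NormedAddCommGroup E'] [NormedSpace ℝ E'] {f : Matrix (Fin 2) (Fin 2) ℂ → E'}
    (hf : ContDiff ℝ ∞ f) (hfc : HasCompactSupport f) :
    ContDiff ℝ ∞ (fun X : Matrix (Fin 2) (Fin 2) ℂ => f ((!![(1 : ℂ), 1; 1, -1] : Matrix (Fin 2) (Fin 2) ℂ) * X * !![(1 / 2 : ℂ), 1 / 2; 1 / 2, -(1 / 2)])) ∧
      HasCompactSupport (fun X : Matrix (Fin 2) (Fin 2) ℂ => f ((!![(1 : ℂ), 1; 1, -1] : Matrix (Fin 2) (Fin 2) ℂ) * X * !![(1 / 2 : ℂ), 1 / 2; 1 / 2, -(1 / 2)])) := by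
  -- adapted from ★ (R1G) `ArchRankOneLimitFormulaGroup` (private `contDiff_hasCompactSupport_comp_conj`)
  refine ⟨hf.comp ((contDiff_const.mul contDiff_id).mul contDiff_const), ?_⟩
  have hAB : (!![(1 : ℂ), 1; 1, -1] : Matrix (Fin 2) (Fin 2) ℂ) * !![(1 / 2 : ℂ), 1 / 2; 1 / 2, -(1 / 2)] = 1 := by
    ext i j; fin_cases i <;> fin_cases j <;> simp [Matrix.mul_apply, Fin.sum_univ_two] <;> norm_num
  have hBA : (!![(1 / 2 : ℂ), 1 / 2; 1 / 2, -(1 / 2)] : Matrix (Fin 2) (Fin 2) ℂ) * !![(1 : ℂ), 1; 1, -1] = 1 := by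
    ext i j; fin_cases i <;> fin_cases j <;> simp [Matrix.mul_apply, Fin.sum_univ_two] <;> norm_num
  let φ : Matrix (Fin 2) (Fin 2) ℂ ≃ₜ Matrix (Fin 2) (Fin 2) ℂ :=
    { toFun := fun X => (!![(1 : ℂ), 1; 1, -1] : Matrix (Fin 2) (Fin 2) ℂ) * X * !![(1 / 2 : ℂ), 1 / 2; 1 / 2, -(1 / 2)]
      invFun := fun X => (!![(1 / 2 : ℂ), 1 / 2; 1 / 2, -(1 / 2)] : Matrix (Fin 2) (Fin 2) ℂ) * X * !![(1 : ℂ), 1; 1, -1]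
      left_inv := fun X => by
        show (!![(1 / 2 : ℂ), 1 / 2; 1 / 2, -(1 / 2)] : Matrix (Fin 2) (Fin 2) ℂ) * ((!![(1 : ℂ), 1; 1, -1] : Matrix (Fin 2) (Fin 2) ℂ) * X *
          !![(1 / 2 : ℂ), 1 / 2; 1 / 2, -(1 / 2)]) * !![(1 : ℂ), 1; 1, -1] = X
        rw [← Matrix.mul_assoc, ← Matrix.mul_assoc, hBA, Matrix.one_mul, Matrix.mul_assoc, hBA, Matrix.mul_one]
      right_inv := fun X => by
        show (!![(1 : ℂ), 1; 1, -1] : Matrix (Fin 2) (Fin 2) ℂ) * ((!![(1 / 2 : ℂ), 1 / 2; 1 / 2, -(1 / 2)] : Matrix (Fin 2) (Fin 2) ℂ) * X *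
          !![(1 : ℂ), 1; 1, -1]) * !![(1 / 2 : ℂ), 1 / 2; 1 / 2, -(1 / 2)] = X
        rw [← Matrix.mul_assoc, ← Matrix.mul_assoc, hAB, Matrix.one_mul, Matrix.mul_assoc, hAB, Matrix.mul_one]
      continuous_toFun := (continuous_const.mul continuous_id).mul continuous_const
      continuous_invFun := (continuous_const.mul continuous_id).mul continuous_const }
  exact hfc.comp_homeomorph φ

end Frame

/-! ## §2 The Cayley-frame functional IS the engine's functional; the heads on `U(Φ₂)_w` -/

section Heads

variable (L : Type) [Field L] [NumberField L] (w : {w : InfinitePlace L // IsComplex w})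
  [MeasurableSpace ↥(archLocal L 2 (Matrix.of fun i j : Fin 2 => if i.val + j.val + 1 = 2 then (1 : L) else 0) w)]
  [BorelSpace ↥(archLocal L 2 (Matrix.of fun i j : Fin 2 => if i.val + j.val + 1 = 2 then (1 : L) else 0) w)]
  (ν : Measure ↥(archLocal L 2 (Matrix.of fun i j : Fin 2 => if i.val + j.val + 1 = 2 then (1 : L) else 0) w)) [ν.IsHaarMeasure] [ν.IsMulRightInvariant]

omit [MeasurableSpace ↥(archLocal L 2 (Matrix.of fun i j : Fin 2 => if i.val + j.val + 1 = 2 then (1 : L) else 0) w)]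
  [BorelSpace ↥(archLocal L 2 (Matrix.of fun i j : Fin 2 => if i.val + j.val + 1 = 2 then (1 : L) else 0) w)] [ν.IsHaarMeasure] [ν.IsMulRightInvariant] in
/-- The engine's side conditions at `a = (2, −2)`: `a_i ≠ 0`, `σ_w(a_i)` real, `re σ_w(2) · re σ_w(−2) < 0`, and `q² σ_w(−2) = −σ_w(2)` with `p = q = 1`. [folklore] -/
private theorem cayleyDiag_frame :
    (∀ i, (![(2 : L), -2]) i ≠ 0) ∧ (∀ i, (w.1.embedding ((![(2 : L), -2]) i)).im = 0) ∧
      (w.1.embedding ((![(2 : L), -2]) 0)).re * (w.1.embedding ((![(2 : L), -2]) 1)).re < 0 ∧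
      ((1 : ℝ) : ℂ) ^ 2 * w.1.embedding ((![(2 : L), -2]) 1) = -w.1.embedding ((![(2 : L), -2]) 0) := by
  have h0 : w.1.embedding ((![(2 : L), -2]) 0) = 2 := by
    rw [show (![(2 : L), -2]) 0 = 2 from rfl, map_ofNat]
  have h1 : w.1.embedding ((![(2 : L), -2]) 1) = -2 := by
    rw [show (![(2 : L), -2]) 1 = -2 from rfl, map_neg, map_ofNat]
  refine ⟨fun i => ?_, fun i => ?_, ?_, ?_⟩
  · fin_cases i
    · show (![(2 : L), -2]) 0 ≠ 0
      rw [show (![(2 : L), -2]) 0 = 2 from rfl]; exact two_ne_zero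
    · show (![(2 : L), -2]) 1 ≠ 0
      rw [show (![(2 : L), -2]) 1 = -2 from rfl]; exact neg_ne_zero.2 two_ne_zero
  · fin_cases i
    · show (w.1.embedding ((![(2 : L), -2]) 0)).im = 0
      rw [h0]; norm_num
    · show (w.1.embedding ((![(2 : L), -2]) 1)).im = 0
      rw [h1]; norm_num
  · rw [h0, h1]; norm_num
  · rw [h0, h1]; norm_num

/-- **THE CAYLEY-FRAME FUNCTIONAL IS THE ENGINE'S FUNCTIONAL** (same function of `ψ`): with `e : U(σ_w diag(2,−2))(ℂ) ≃ₜ* U(Φ₂)_w` the Cayley congruence and `μ = ν.map e⁻¹`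
(Haar, right invariant), for every `f : M₂(ℂ) → E`, `z ∈ S¹` and EVERY `ψ`:
`2 sin ψ • ∫_{U(Φ₂)_w} f(↑↑(h · P t_z(ψ) P⁻¹ · h⁻¹)) dν = 2 sin ψ • ∫_{U(σ_w diag(2,−2))} (X ↦ f(P X P⁻¹))(↑↑(h′ t_z(ψ) h′⁻¹)) dμ` (★ `integral_comp_conj_transport`: the torus point moves with the frame).
[cite: Rogawski1990, §8.2 pp. 119, 122] [cite: PlatonovRapinchuk1994, §2.3] -/
theorem exists_two_sin_smul_orbitalIntegral_cayley_eq :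
    ∃ (e : ↥(unitaryGroupOfForm (starRingEnd ℂ) ((Matrix.diagonal ![(2 : L), -2]).map w.1.embedding)) ≃ₜ*
        ↥(archLocal L 2 (Matrix.of fun i j : Fin 2 => if i.val + j.val + 1 = 2 then (1 : L) else 0) w)),
      (letI : MeasurableSpace ↥(unitaryGroupOfForm (starRingEnd ℂ) ((Matrix.diagonal ![(2 : L), -2]).map w.1.embedding)) := borel _
       (ν.map e.symm).IsHaarMeasure ∧ (ν.map e.symm).IsMulRightInvariant ∧
       ∀ (f : Matrix (Fin 2) (Fin 2) ℂ → E) (z : Circle) (ψ : ℝ),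
        (2 * Real.sin ψ) • ∫ h : ↥(archLocal L 2 (Matrix.of fun i j : Fin 2 => if i.val + j.val + 1 = 2 then (1 : L) else 0) w),
            f (((h * ⟨Matrix.GeneralLinearGroup.mkOfDetNeZero !![(1 : ℂ), 1; 1, -1] det_cayleyTwo_ne_zero *
                  circleDiagonal 2 ![z * Circle.exp ψ, z * Circle.exp (-ψ)] *
                  (Matrix.GeneralLinearGroup.mkOfDetNeZero !![(1 : ℂ), 1; 1, -1] det_cayleyTwo_ne_zero)⁻¹,
                cayley_conj_circleDiagonal_mem_archLocal L w _⟩ * h⁻¹ :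
              ↥(archLocal L 2 (Matrix.of fun i j : Fin 2 => if i.val + j.val + 1 = 2 then (1 : L) else 0) w)) : GL (Fin 2) ℂ) : Matrix (Fin 2) (Fin 2) ℂ) ∂ν =
        (2 * Real.sin ψ) • ∫ h' : ↥(unitaryGroupOfForm (starRingEnd ℂ) ((Matrix.diagonal ![(2 : L), -2]).map w.1.embedding)),
            (fun X : Matrix (Fin 2) (Fin 2) ℂ => f ((!![(1 : ℂ), 1; 1, -1] : Matrix (Fin 2) (Fin 2) ℂ) * X * !![(1 / 2 : ℂ), 1 / 2; 1 / 2, -(1 / 2)]))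
              (((h' * ⟨circleDiagonal 2 ![z * Circle.exp ψ, z * Circle.exp (-ψ)], circleDiagonal_mem_archLocal_diagonal L 2 ![(2 : L), -2] w _⟩ * h'⁻¹ :
                ↥(unitaryGroupOfForm (starRingEnd ℂ) ((Matrix.diagonal ![(2 : L), -2]).map w.1.embedding))) : GL (Fin 2) ℂ) : Matrix (Fin 2) (Fin 2) ℂ) ∂(ν.map e.symm)) := by
  letI : MeasurableSpace ↥(unitaryGroupOfForm (starRingEnd ℂ) ((Matrix.diagonal ![(2 : L), -2]).map w.1.embedding)) := borel _
  haveI : BorelSpace ↥(unitaryGroupOfForm (starRingEnd ℂ) ((Matrix.diagonal ![(2 : L), -2]).map w.1.embedding)) := ⟨rfl⟩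
  obtain ⟨e, he⟩ := exists_cayleyEquiv_diagonal L w
  refine ⟨e, e.symm.isHaarMeasure_map ν, isMulRightInvariant_map_mulEquiv'' e.symm.toMulEquiv e.symm.continuous.measurable ν, fun f z ψ => ?_⟩
  -- the torus point moves with the frame: `⟨P γ P⁻¹, _⟩ = e ⟨γ, _⟩`
  have hγ : (⟨Matrix.GeneralLinearGroup.mkOfDetNeZero !![(1 : ℂ), 1; 1, -1] det_cayleyTwo_ne_zero *
        circleDiagonal 2 ![z * Circle.exp ψ, z * Circle.exp (-ψ)] * (Matrix.GeneralLinearGroup.mkOfDetNeZero !![(1 : ℂ), 1; 1, -1] det_cayleyTwo_ne_zero)⁻¹,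
        cayley_conj_circleDiagonal_mem_archLocal L w _⟩ :
      ↥(archLocal L 2 (Matrix.of fun i j : Fin 2 => if i.val + j.val + 1 = 2 then (1 : L) else 0) w)) =
      e ⟨circleDiagonal 2 ![z * Circle.exp ψ, z * Circle.exp (-ψ)], circleDiagonal_mem_archLocal_diagonal L 2 ![(2 : L), -2] w _⟩ :=
    Subtype.ext (he ⟨circleDiagonal 2 ![z * Circle.exp ψ, z * Circle.exp (-ψ)], circleDiagonal_mem_archLocal_diagonal L 2 ![(2 : L), -2] w _⟩).symm
  rw [hγ, integral_comp_conj_transport _ _ e _ he ν f, Matrix.GeneralLinearGroup.val_mkOfDetNeZero, coe_inv_cayleyTwo]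

variable [CompleteSpace E]

/-- **BOUNDED JETS NEAR THE COMPACT WALL, CAYLEY FRAME** (the one-place `h2` at a compact place of `H_∞`): for every Haar `ν` on `U(Φ₂)_w`, every `f ∈ C_c^∞(M₂(ℂ), E)`, `z ∈ S¹` and `n`
there is `B` with `‖∂_ψⁿ [2 sin ψ · ∫_{U(Φ₂)_w} f(↑↑(h · P t_z(ψ) P⁻¹ · h⁻¹)) dν]‖ ≤ B` on a punctured neighbourhood of `ψ = 0` — ★ `exists_forall_eventually_norm_iteratedDeriv_orbitalIntegral_le` at
`a = (2,−2)` transported. [cite: Varadarajan1989, §6.4 Thm 22] [cite: Bouaziz1994IntegralesOrbitales, §3.1 (I₂) p. 579] [cite: Rogawski1990, §8.2 p. 122] -/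
theorem exists_forall_eventually_norm_iteratedDeriv_orbitalIntegral_cayley_le
    (F : (Matrix (Fin 2) (Fin 2) ℂ → E) → ℝ → E) (z : Circle)
    (hF : ∀ (f : Matrix (Fin 2) (Fin 2) ℂ → E) (ψ : ℝ), F f ψ = (2 * Real.sin ψ) •
      ∫ h : ↥(archLocal L 2 (Matrix.of fun i j : Fin 2 => if i.val + j.val + 1 = 2 then (1 : L) else 0) w),
        f (((h * ⟨Matrix.GeneralLinearGroup.mkOfDetNeZero !![(1 : ℂ), 1; 1, -1] det_cayleyTwo_ne_zero *
              circleDiagonal 2 ![z * Circle.exp ψ, z * Circle.exp (-ψ)] *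
              (Matrix.GeneralLinearGroup.mkOfDetNeZero !![(1 : ℂ), 1; 1, -1] det_cayleyTwo_ne_zero)⁻¹,
            cayley_conj_circleDiagonal_mem_archLocal L w _⟩ * h⁻¹ :
          ↥(archLocal L 2 (Matrix.of fun i j : Fin 2 => if i.val + j.val + 1 = 2 then (1 : L) else 0) w)) : GL (Fin 2) ℂ) : Matrix (Fin 2) (Fin 2) ℂ) ∂ν)
    {f : Matrix (Fin 2) (Fin 2) ℂ → E} (hf : ContDiff ℝ ∞ f) (hfc : HasCompactSupport f) (n : ℕ) :
    ∃ B : ℝ, ∀ᶠ ψ in 𝓝[≠] (0 : ℝ), ‖iteratedDeriv n (F f) ψ‖ ≤ B := by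
  obtain ⟨e, hH, hR, hkey⟩ := exists_two_sin_smul_orbitalIntegral_cayley_eq (E := E) L w ν
  letI : MeasurableSpace ↥(unitaryGroupOfForm (starRingEnd ℂ) ((Matrix.diagonal ![(2 : L), -2]).map w.1.embedding)) := borel _
  haveI : BorelSpace ↥(unitaryGroupOfForm (starRingEnd ℂ) ((Matrix.diagonal ![(2 : L), -2]).map w.1.embedding)) := ⟨rfl⟩
  haveI := hH
  haveI := hR
  obtain ⟨ha, hreal, hsgn, hqe⟩ := cayleyDiag_frame L w
  obtain ⟨hfP, hfPc⟩ := contDiff_hasCompactSupport_comp_cayley hf hfc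
  -- the engine's functional on `U(σ_w diag(2,−2))` at `μ = ν.map e⁻¹`, and the engine's Casimir (`p = q = 1`)
  obtain ⟨B, hB⟩ := exists_forall_eventually_norm_iteratedDeriv_orbitalIntegral_le (E := E) L ![(2 : L), -2] w ha hreal hsgn (p := 1) (q := 1) (by norm_num) hqe
    (ν.map e.symm) (fun g Y =>
      -(fderiv ℝ (fderiv ℝ g) Y (Y * !![I, 0; 0, -I]) (Y * !![I, 0; 0, -I]) + fderiv ℝ g Y (Y * !![I, 0; 0, -I] * !![I, 0; 0, -I])) +
        (fderiv ℝ (fderiv ℝ g) Y (Y * !![(0 : ℂ), ((1 : ℝ) : ℂ); ((1 : ℝ) : ℂ), 0]) (Y * !![(0 : ℂ), ((1 : ℝ) : ℂ); ((1 : ℝ) : ℂ), 0]) +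
          fderiv ℝ g Y (Y * !![(0 : ℂ), ((1 : ℝ) : ℂ); ((1 : ℝ) : ℂ), 0] * !![(0 : ℂ), ((1 : ℝ) : ℂ); ((1 : ℝ) : ℂ), 0])) +
        (fderiv ℝ (fderiv ℝ g) Y (Y * !![(0 : ℂ), -(((1 : ℝ) : ℂ) * I); ((1 : ℝ) : ℂ) * I, 0]) (Y * !![(0 : ℂ), -(((1 : ℝ) : ℂ) * I); ((1 : ℝ) : ℂ) * I, 0]) +
          fderiv ℝ g Y (Y * !![(0 : ℂ), -(((1 : ℝ) : ℂ) * I); ((1 : ℝ) : ℂ) * I, 0] * !![(0 : ℂ), -(((1 : ℝ) : ℂ) * I); ((1 : ℝ) : ℂ) * I, 0])))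
    (fun _ _ => rfl) z
    (fun g ψ => (2 * Real.sin ψ) • ∫ h' : ↥(unitaryGroupOfForm (starRingEnd ℂ) ((Matrix.diagonal ![(2 : L), -2]).map w.1.embedding)),
      g (((h' * ⟨circleDiagonal 2 ![z * Circle.exp ψ, z * Circle.exp (-ψ)], circleDiagonal_mem_archLocal_diagonal L 2 ![(2 : L), -2] w _⟩ * h'⁻¹ :
        ↥(unitaryGroupOfForm (starRingEnd ℂ) ((Matrix.diagonal ![(2 : L), -2]).map w.1.embedding))) : GL (Fin 2) ℂ) : Matrix (Fin 2) (Fin 2) ℂ) ∂(ν.map e.symm))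
    (fun _ _ => rfl) hfP hfPc n
  refine ⟨B, ?_⟩
  have hfun : F f = fun ψ => (2 * Real.sin ψ) • ∫ h' : ↥(unitaryGroupOfForm (starRingEnd ℂ) ((Matrix.diagonal ![(2 : L), -2]).map w.1.embedding)),
      (fun X : Matrix (Fin 2) (Fin 2) ℂ => f ((!![(1 : ℂ), 1; 1, -1] : Matrix (Fin 2) (Fin 2) ℂ) * X * !![(1 / 2 : ℂ), 1 / 2; 1 / 2, -(1 / 2)]))
        (((h' * ⟨circleDiagonal 2 ![z * Circle.exp ψ, z * Circle.exp (-ψ)], circleDiagonal_mem_archLocal_diagonal L 2 ![(2 : L), -2] w _⟩ * h'⁻¹ :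
          ↥(unitaryGroupOfForm (starRingEnd ℂ) ((Matrix.diagonal ![(2 : L), -2]).map w.1.embedding))) : GL (Fin 2) ℂ) : Matrix (Fin 2) (Fin 2) ℂ) ∂(ν.map e.symm) :=
    funext fun ψ => (hF f ψ).trans (hkey f z ψ)
  rw [hfun]
  exact hB

/-- **EVERY JET HAS ONE-SIDED LIMITS AT THE COMPACT WALL, CAYLEY FRAME** — ★ `exists_tendsto_iteratedDeriv_orbitalIntegral_nhdsGT_nhdsLT` transported.
[cite: Varadarajan1989, §6.4 Thms 22–24] [cite: Bouaziz1994IntegralesOrbitales, §3.1 (I₂) p. 579] -/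
theorem exists_tendsto_iteratedDeriv_orbitalIntegral_cayley_nhdsGT_nhdsLT
    (F : (Matrix (Fin 2) (Fin 2) ℂ → E) → ℝ → E) (z : Circle)
    (hF : ∀ (f : Matrix (Fin 2) (Fin 2) ℂ → E) (ψ : ℝ), F f ψ = (2 * Real.sin ψ) •
      ∫ h : ↥(archLocal L 2 (Matrix.of fun i j : Fin 2 => if i.val + j.val + 1 = 2 then (1 : L) else 0) w),
        f (((h * ⟨Matrix.GeneralLinearGroup.mkOfDetNeZero !![(1 : ℂ), 1; 1, -1] det_cayleyTwo_ne_zero *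
              circleDiagonal 2 ![z * Circle.exp ψ, z * Circle.exp (-ψ)] *
              (Matrix.GeneralLinearGroup.mkOfDetNeZero !![(1 : ℂ), 1; 1, -1] det_cayleyTwo_ne_zero)⁻¹,
            cayley_conj_circleDiagonal_mem_archLocal L w _⟩ * h⁻¹ :
          ↥(archLocal L 2 (Matrix.of fun i j : Fin 2 => if i.val + j.val + 1 = 2 then (1 : L) else 0) w)) : GL (Fin 2) ℂ) : Matrix (Fin 2) (Fin 2) ℂ) ∂ν)
    {f : Matrix (Fin 2) (Fin 2) ℂ → E} (hf : ContDiff ℝ ∞ f) (hfc : HasCompactSupport f) (n : ℕ) :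
    ∃ Lp Lm : E, Tendsto (fun ψ => iteratedDeriv n (F f) ψ) (𝓝[>] 0) (𝓝 Lp) ∧ Tendsto (fun ψ => iteratedDeriv n (F f) ψ) (𝓝[<] 0) (𝓝 Lm) := by
  obtain ⟨e, hH, hR, hkey⟩ := exists_two_sin_smul_orbitalIntegral_cayley_eq (E := E) L w ν
  letI : MeasurableSpace ↥(unitaryGroupOfForm (starRingEnd ℂ) ((Matrix.diagonal ![(2 : L), -2]).map w.1.embedding)) := borel _
  haveI : BorelSpace ↥(unitaryGroupOfForm (starRingEnd ℂ) ((Matrix.diagonal ![(2 : L), -2]).map w.1.embedding)) := ⟨rfl⟩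
  haveI := hH
  haveI := hR
  obtain ⟨ha, hreal, hsgn, hqe⟩ := cayleyDiag_frame L w
  obtain ⟨hfP, hfPc⟩ := contDiff_hasCompactSupport_comp_cayley hf hfc
  obtain ⟨Lp, Lm, hp, hm⟩ := exists_tendsto_iteratedDeriv_orbitalIntegral_nhdsGT_nhdsLT (E := E) L ![(2 : L), -2] w ha hreal hsgn (p := 1) (q := 1) (by norm_num) hqe
    (ν.map e.symm) (fun g Y =>
      -(fderiv ℝ (fderiv ℝ g) Y (Y * !![I, 0; 0, -I]) (Y * !![I, 0; 0, -I]) + fderiv ℝ g Y (Y * !![I, 0; 0, -I] * !![I, 0; 0, -I])) +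
        (fderiv ℝ (fderiv ℝ g) Y (Y * !![(0 : ℂ), ((1 : ℝ) : ℂ); ((1 : ℝ) : ℂ), 0]) (Y * !![(0 : ℂ), ((1 : ℝ) : ℂ); ((1 : ℝ) : ℂ), 0]) +
          fderiv ℝ g Y (Y * !![(0 : ℂ), ((1 : ℝ) : ℂ); ((1 : ℝ) : ℂ), 0] * !![(0 : ℂ), ((1 : ℝ) : ℂ); ((1 : ℝ) : ℂ), 0])) +
        (fderiv ℝ (fderiv ℝ g) Y (Y * !![(0 : ℂ), -(((1 : ℝ) : ℂ) * I); ((1 : ℝ) : ℂ) * I, 0]) (Y * !![(0 : ℂ), -(((1 : ℝ) : ℂ) * I); ((1 : ℝ) : ℂ) * I, 0]) +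
          fderiv ℝ g Y (Y * !![(0 : ℂ), -(((1 : ℝ) : ℂ) * I); ((1 : ℝ) : ℂ) * I, 0] * !![(0 : ℂ), -(((1 : ℝ) : ℂ) * I); ((1 : ℝ) : ℂ) * I, 0])))
    (fun _ _ => rfl) z
    (fun g ψ => (2 * Real.sin ψ) • ∫ h' : ↥(unitaryGroupOfForm (starRingEnd ℂ) ((Matrix.diagonal ![(2 : L), -2]).map w.1.embedding)),
      g (((h' * ⟨circleDiagonal 2 ![z * Circle.exp ψ, z * Circle.exp (-ψ)], circleDiagonal_mem_archLocal_diagonal L 2 ![(2 : L), -2] w _⟩ * h'⁻¹ :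
        ↥(unitaryGroupOfForm (starRingEnd ℂ) ((Matrix.diagonal ![(2 : L), -2]).map w.1.embedding))) : GL (Fin 2) ℂ) : Matrix (Fin 2) (Fin 2) ℂ) ∂(ν.map e.symm))
    (fun _ _ => rfl) hfP hfPc n
  refine ⟨Lp, Lm, ?_⟩
  have hfun : F f = fun ψ => (2 * Real.sin ψ) • ∫ h' : ↥(unitaryGroupOfForm (starRingEnd ℂ) ((Matrix.diagonal ![(2 : L), -2]).map w.1.embedding)),
      (fun X : Matrix (Fin 2) (Fin 2) ℂ => f ((!![(1 : ℂ), 1; 1, -1] : Matrix (Fin 2) (Fin 2) ℂ) * X * !![(1 / 2 : ℂ), 1 / 2; 1 / 2, -(1 / 2)]))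
        (((h' * ⟨circleDiagonal 2 ![z * Circle.exp ψ, z * Circle.exp (-ψ)], circleDiagonal_mem_archLocal_diagonal L 2 ![(2 : L), -2] w _⟩ * h'⁻¹ :
          ↥(unitaryGroupOfForm (starRingEnd ℂ) ((Matrix.diagonal ![(2 : L), -2]).map w.1.embedding))) : GL (Fin 2) ℂ) : Matrix (Fin 2) (Fin 2) ℂ) ∂(ν.map e.symm) :=
    funext fun ψ => (hF f ψ).trans (hkey f z ψ)
  rw [hfun]
  exact ⟨hp, hm⟩

variable {E' : Type*} [NormedAddCommGroup E'] [NormedSpace ℝ E'] [CompleteSpace E']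

/-- **UNIFORM BOUNDED JETS OVER A CURRIED FAMILY, CAYLEY FRAME** (★ (ELL-∞-UNIF) `exists_forall_eventually_norm_iteratedDeriv_orbitalIntegral_comp_clm_le` transported): for
`g ∈ C_c^∞(M₂(ℂ), E′)` and `n` there is `B ≥ 0` with `‖∂_ψⁿ [2 sin ψ · ∫_{U(Φ₂)_w} (ℓ ∘ g)(↑↑(h · P t_z(ψ) P⁻¹ · h⁻¹)) dν]‖ ≤ ‖ℓ‖ · B` on ONE punctured neighbourhood of the wall,
simultaneously for all `ℓ : E′ →L[ℝ] E` — the `P →ᵇ E` uniformity of Bouaziz (I₂) at a compact place of `H_∞`, in the tree's frame (the multi-place transport curries the other places'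
leaf variables into `g`). [cite: Bouaziz1994IntegralesOrbitales, §3.1 (I₁)–(I₂) p. 579] [cite: Varadarajan1989, §6.4 Thm 22] [cite: Rogawski1990, §8.2 p. 122] -/
theorem exists_forall_eventually_norm_iteratedDeriv_orbitalIntegral_cayley_comp_clm_le
    (F : (Matrix (Fin 2) (Fin 2) ℂ → E) → ℝ → E) (z : Circle)
    (hF : ∀ (f : Matrix (Fin 2) (Fin 2) ℂ → E) (ψ : ℝ), F f ψ = (2 * Real.sin ψ) •
      ∫ h : ↥(archLocal L 2 (Matrix.of fun i j : Fin 2 => if i.val + j.val + 1 = 2 then (1 : L) else 0) w),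
        f (((h * ⟨Matrix.GeneralLinearGroup.mkOfDetNeZero !![(1 : ℂ), 1; 1, -1] det_cayleyTwo_ne_zero *
              circleDiagonal 2 ![z * Circle.exp ψ, z * Circle.exp (-ψ)] *
              (Matrix.GeneralLinearGroup.mkOfDetNeZero !![(1 : ℂ), 1; 1, -1] det_cayleyTwo_ne_zero)⁻¹,
            cayley_conj_circleDiagonal_mem_archLocal L w _⟩ * h⁻¹ :
          ↥(archLocal L 2 (Matrix.of fun i j : Fin 2 => if i.val + j.val + 1 = 2 then (1 : L) else 0) w)) : GL (Fin 2) ℂ) : Matrix (Fin 2) (Fin 2) ℂ) ∂ν)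
    {g : Matrix (Fin 2) (Fin 2) ℂ → E'} (hg : ContDiff ℝ ∞ g) (hgc : HasCompactSupport g) (n : ℕ) :
    ∃ B : ℝ, 0 ≤ B ∧ ∀ᶠ ψ in 𝓝[≠] (0 : ℝ), ∀ ℓ : E' →L[ℝ] E, ‖iteratedDeriv n (F (fun X => ℓ (g X))) ψ‖ ≤ ‖ℓ‖ * B := by
  obtain ⟨e, hH, hR, hkey⟩ := exists_two_sin_smul_orbitalIntegral_cayley_eq (E := E) L w ν
  letI : MeasurableSpace ↥(unitaryGroupOfForm (starRingEnd ℂ) ((Matrix.diagonal ![(2 : L), -2]).map w.1.embedding)) := borel _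
  haveI : BorelSpace ↥(unitaryGroupOfForm (starRingEnd ℂ) ((Matrix.diagonal ![(2 : L), -2]).map w.1.embedding)) := ⟨rfl⟩
  haveI := hH
  haveI := hR
  obtain ⟨ha, hreal, hsgn, hqe⟩ := cayleyDiag_frame L w
  obtain ⟨hgP, hgPc⟩ := contDiff_hasCompactSupport_comp_cayley hg hgc
  obtain ⟨B, hB0, hB⟩ := exists_forall_eventually_norm_iteratedDeriv_orbitalIntegral_comp_clm_le (E := E) (E' := E') L ![(2 : L), -2] w ha hreal hsgn
    (p := 1) (q := 1) (by norm_num) hqe (ν.map e.symm) (fun g Y =>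
      -(fderiv ℝ (fderiv ℝ g) Y (Y * !![I, 0; 0, -I]) (Y * !![I, 0; 0, -I]) + fderiv ℝ g Y (Y * !![I, 0; 0, -I] * !![I, 0; 0, -I])) +
        (fderiv ℝ (fderiv ℝ g) Y (Y * !![(0 : ℂ), ((1 : ℝ) : ℂ); ((1 : ℝ) : ℂ), 0]) (Y * !![(0 : ℂ), ((1 : ℝ) : ℂ); ((1 : ℝ) : ℂ), 0]) +
          fderiv ℝ g Y (Y * !![(0 : ℂ), ((1 : ℝ) : ℂ); ((1 : ℝ) : ℂ), 0] * !![(0 : ℂ), ((1 : ℝ) : ℂ); ((1 : ℝ) : ℂ), 0])) +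
        (fderiv ℝ (fderiv ℝ g) Y (Y * !![(0 : ℂ), -(((1 : ℝ) : ℂ) * I); ((1 : ℝ) : ℂ) * I, 0]) (Y * !![(0 : ℂ), -(((1 : ℝ) : ℂ) * I); ((1 : ℝ) : ℂ) * I, 0]) +
          fderiv ℝ g Y (Y * !![(0 : ℂ), -(((1 : ℝ) : ℂ) * I); ((1 : ℝ) : ℂ) * I, 0] * !![(0 : ℂ), -(((1 : ℝ) : ℂ) * I); ((1 : ℝ) : ℂ) * I, 0])))
    (fun _ _ => rfl) z
    (fun f ψ => (2 * Real.sin ψ) • ∫ h' : ↥(unitaryGroupOfForm (starRingEnd ℂ) ((Matrix.diagonal ![(2 : L), -2]).map w.1.embedding)),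
      f (((h' * ⟨circleDiagonal 2 ![z * Circle.exp ψ, z * Circle.exp (-ψ)], circleDiagonal_mem_archLocal_diagonal L 2 ![(2 : L), -2] w _⟩ * h'⁻¹ :
        ↥(unitaryGroupOfForm (starRingEnd ℂ) ((Matrix.diagonal ![(2 : L), -2]).map w.1.embedding))) : GL (Fin 2) ℂ) : Matrix (Fin 2) (Fin 2) ℂ) ∂(ν.map e.symm))
    (fun _ _ => rfl)
    (fun g ψ => (2 * Real.sin ψ) • ∫ h' : ↥(unitaryGroupOfForm (starRingEnd ℂ) ((Matrix.diagonal ![(2 : L), -2]).map w.1.embedding)),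
      g (((h' * ⟨circleDiagonal 2 ![z * Circle.exp ψ, z * Circle.exp (-ψ)], circleDiagonal_mem_archLocal_diagonal L 2 ![(2 : L), -2] w _⟩ * h'⁻¹ :
        ↥(unitaryGroupOfForm (starRingEnd ℂ) ((Matrix.diagonal ![(2 : L), -2]).map w.1.embedding))) : GL (Fin 2) ℂ) : Matrix (Fin 2) (Fin 2) ℂ) ∂(ν.map e.symm))
    (fun _ _ => rfl) hgP hgPc n
  refine ⟨B, hB0, ?_⟩
  filter_upwards [hB] with ψ hψ ℓ
  have hfun : F (fun X => ℓ (g X)) = fun ψ => (2 * Real.sin ψ) • ∫ h' : ↥(unitaryGroupOfForm (starRingEnd ℂ) ((Matrix.diagonal ![(2 : L), -2]).map w.1.embedding)),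
      (fun X : Matrix (Fin 2) (Fin 2) ℂ => ℓ ((fun X : Matrix (Fin 2) (Fin 2) ℂ => g ((!![(1 : ℂ), 1; 1, -1] : Matrix (Fin 2) (Fin 2) ℂ) * X * !![(1 / 2 : ℂ), 1 / 2; 1 / 2, -(1 / 2)])) X))
        (((h' * ⟨circleDiagonal 2 ![z * Circle.exp ψ, z * Circle.exp (-ψ)], circleDiagonal_mem_archLocal_diagonal L 2 ![(2 : L), -2] w _⟩ * h'⁻¹ :
          ↥(unitaryGroupOfForm (starRingEnd ℂ) ((Matrix.diagonal ![(2 : L), -2]).map w.1.embedding))) : GL (Fin 2) ℂ) : Matrix (Fin 2) (Fin 2) ℂ) ∂(ν.map e.symm) :=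
    funext fun ψ => (hF _ ψ).trans (hkey (fun X => ℓ (g X)) z ψ)
  rw [hfun]
  exact hψ ℓ

end Heads

end Literature.NumberTheory.Automorphic.UnitaryGroup

end
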